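import Summits.ResolutionOfSingularities.ResolutionOfSingularities.Theorems.EquisingularLiftEquisingularLiftNatGEPrincipalIdeals
import Literature.AlgebraicGeometry.FormalGeometry.GrothendieckExistence
import Literature.AlgebraicGeometry.Deformation.BaseChangeKernelIdeal
import Literature.AlgebraicGeometry.Resolution.IdealSheafDescent
import Mathlib.AlgebraicGeometry.IdealSheaf.Functorial
import Mathlib.RingTheory.PrincipalIdealDomain
import HarnessLib

/-!
# [OURS · L1 W4.5(b) · EL♮(3) · F-88♭ brick 3] **F-88♭ AS A THEOREM**: Grothendieck's existence theorem for CLOSED FORMAL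
# SUBSCHEMES (Görtz–Wedhorn II Prop. 24.109 / EGA III₁ Cor. 5.1.8) for a PRINCIPAL ideal of definition — literally the body of the
# tree's NAMED FACT `Literature.AlgebraicGeometry.FormalGeometry.GrothendieckExistence` (F-88) with `I := Ideal.span {a}`, PROVED

Crux chain w45b (cell `res-hironaka`, slot W4.5(b)), working crux **EL♮** = stmt-ResolutionOfSingularities-20038, child **EL♮(3)** =
stmt-ResolutionOfSingularities-20148, route EquisingularLift, line `sections`. Written by res-type-027 g23 (INPUTS ADDENDUM 8 §2 option (A);
res-inputs-crit-1 R176: «F-88♭ must land ONLY as a THEOREM … type = F-88's body with `I := Ideal.span {a}`, `.{u}`» — this file; R186).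
WHY IT MATTERS FOR THE CRUX: the registered NEED-FACT stub `stub_elnat_grothendieckExistence : GrothendieckExistence.{0}` (F-88, general
ideal of definition `I`) is consumed at exactly one kind of kernel site — `hGE (IsLocalRing.maximalIdeal O) w T j s hjc hs` with `O` a
complete discrete valuation ring (p598091 `embeddedLiftFact_of_infinitesimal_of_grothendieckExistence`; likewise nose-w1's
`exists_flat_lift_of_firstOrder`) — and `𝔪_O` is PRINCIPAL, so `grothendieckExistence_of_isPrincipalIdealRing (IsLocalRing.maximalIdeal O)`
below is a DROP-IN replacement for `hGE (IsLocalRing.maximalIdeal O)` there (twin files follow): the door's closes through F-88 become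
UNCONDITIONAL. HONEST FRAMING: OURS glue (≈ EGA III₁ 5.1.8's reduction to 5.1.4) around published theorems that are ALREADY KERNEL
THEOREMS in the tree (GW II Thm. 24.94 along one global function, `FormalGeometry/WittGEUnitBoundStepII`; Cor. 24.100,
`Morphisms/FormalModuleHomCoh`); the general-`I` F-88 is NOT proved here (R186's induction on generators = optional phase 3); nothing
of H. Hironaka's 2017 manuscript is involved or attributed; AI-written, gate-checked, weaker than expert review. No `sorry`; standard
axioms; DEF-FREE. `--supports stmt-ResolutionOfSingularities-20148 --as helper`.

RESULTS (namespace `…Sections.GEPrincipal`).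
* `grothendieckExistence_principal (a : A) [IsAdicComplete (Ideal.span {a}) A] (f : X ⟶ Spec A) [IsProper f] T j s hj hs :
  ∃ T' i, IsClosedImmersion i ∧ ∃ r, ∀ n, IsPullback (r n) (j n) i (ι (Ideal.span {a}) f n)` — F-88's body VERBATIM with
  `I := Ideal.span {a}` (A noetherian; `.{u}`);
* `grothendieckExistence_of_exists_eq_span (I) (hI : ∃ a, I = Ideal.span {a}) [IsAdicComplete I A] …` — F-88's binders plus
  principality; `grothendieckExistence_of_isPrincipalIdealRing [IsPrincipalIdealRing A] (I) [IsAdicComplete I A] …` — the DVR door.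
* Plumbing of independent use: `map_sup_of_isClosedImmersion`, `map_comap_of_isClosedImmersion` (`(J·𝒪_Z)` pushed to `Y` is
  `J + 𝓘_Z`), `ker_comp_eq_sup_of_isPullback` (ideal of `T = T' ×_{X₂} X₁` in `X` is `𝓘_{T'} + 𝓘_{X₁}`), `ker_ι_eq` (the ideal of
  the thickening `X ×_A A/Iⁿ⁺¹ ↪ X` is `Iⁿ⁺¹·𝒪_X`, ANY `I`, via the tree's `Deformation.ker_eq_idealSheafOfIdeal_ker`),
  `ker_ι_span_eq_powIdeal`, `isClosedImmersion_transition` (any universe), `Ideal.comap_sup_of_surjective`.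

PROOF of `grothendieckExistence_principal`. `K_n := 𝓘(T_n ↪ X_n ↪ X)`; the cartesian square `T_n = T_{n+1} ×_{X_{n+1}} X_n` gives
`K_n = K_{n+1} + 𝓘(X_n ↪ X)` (`ker_comp_eq_sup_of_isPullback`: Mathlib `ker_fst_of_isClosedImmersion` + pushing forward along the closed
immersions) and `𝓘(X_n ↪ X) = (α)ⁿ⁺¹`, `α = f♯a` (`ker_ι_span_eq_powIdeal`); brick 2 (`…NatGEPrincipalIdeals.exists_idealSheaf_forall_eq_sup`,
the module-side Grothendieck existence + full faithfulness + Nakayama) yields ONE ideal sheaf `K'` with `K_n = K' + (α)ⁿ⁺¹`; `T' := V(K')`,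
`i := V(K') ↪ X`, `r n : T_n → T'` by `IsClosedImmersion.lift` (`K' ≤ K_n`), and the square `T_n = T' ×_X X_n` is cartesian by Mathlib
`isPullback_of_isClosedImmersion`, since both closed subschemes of `X_n` have ideal `K_n·𝒪_{X_n}`:
`K'.comap ι_n = (K' + 𝓘(X_n)).comap ι_n = K_n.comap ι_n = 𝓘(T_n ↪ X_n)` (`comap_sup`, `comap_map_of_isClosedImmersion`).

References (method / index only): A. Grothendieck, EGA III₁ (1961), Thm. 5.1.4, Cor. 5.1.8; U. Görtz, T. Wedhorn, *Algebraic Geometry II*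
(2023), Def. 24.82–24.84, Thm. 24.94, Cor. 24.100, Prop. 24.109 (pp. 556–577); *Algebraic Geometry I* (2020), Prop. 4.20; The Stacks
Project, Tags 0898, 089A.
-/

set_option linter.dupNamespace false -- mandated namespace `Summit.<Summit>.<Problem>` of this single-conjunct summit

noncomputable section

open CategoryTheory CategoryTheory.Limits AlgebraicGeometry TopologicalSpace Opposite
open AlgebraicGeometry.Scheme.IdealSheafData
open Literature.AlgebraicGeometry.Morphisms
open Literature.AlgebraicGeometry.Morphisms.infinitesimalNeighbourhood (ι toSpec transition transition_ι base)

universe u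

namespace Summit.ResolutionOfSingularities.ResolutionOfSingularities.Cruxes.EquisingularLiftNat.Sections

namespace GEPrincipal

/-! ### Ideal sheaves and closed immersions: `map` along a closed immersion -/

section ClosedImmersion

variable {Z Y : Scheme.{u}} (c : Z ⟶ Y) [IsClosedImmersion c]

/-- Pulling back ideals along a SURJECTIVE ring map preserves `⊔`. [folklore] -/
theorem comap_sup_of_surjective {R S : Type*} [CommRing R] [CommRing S] (π : R →+* S)
    (hπ : Function.Surjective π) (J₁ J₂ : Ideal S) :
    (J₁ ⊔ J₂).comap π = J₁.comap π ⊔ J₂.comap π := by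
  apply le_antisymm
  · intro x hx
    rw [Ideal.mem_comap] at hx
    obtain ⟨y₁, hy₁, y₂, hy₂, hsum⟩ := Submodule.mem_sup.mp hx
    obtain ⟨x₁, rfl⟩ := hπ y₁
    obtain ⟨x₂, rfl⟩ := hπ y₂
    have hk : x - (x₁ + x₂) ∈ J₁.comap π := by
      rw [Ideal.mem_comap, map_sub, map_add, hsum, sub_self]
      exact J₁.zero_mem
    have hx₁ : x₁ ∈ J₁.comap π := hy₁
    have hx₂ : x₂ ∈ J₂.comap π := hy₂
    have : x = (x - (x₁ + x₂) + x₁) + x₂ := by ring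
    rw [this]
    exact Ideal.add_mem _ (Ideal.mem_sup_left (Ideal.add_mem _ hk hx₁)) (Ideal.mem_sup_right hx₂)
  · exact sup_le (Ideal.comap_mono le_sup_left) (Ideal.comap_mono le_sup_right)

/-- **Pushing forward ideal sheaves along a closed immersion preserves `⊔`.** [folklore] -/
theorem map_sup_of_isClosedImmersion (J₁ J₂ : Z.IdealSheafData) :
    (J₁ ⊔ J₂).map c = J₁.map c ⊔ J₂.map c := by
  refine Scheme.IdealSheafData.ext (funext fun U => ?_)
  rw [ideal_sup, Pi.sup_apply, ideal_map_of_isAffineHom, ideal_map_of_isAffineHom, ideal_map_of_isAffineHom,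
    ideal_sup, Pi.sup_apply, comap_sup_of_surjective _ (c.app_surjective U U.2)]

/-- **`(J·𝒪_Z) pushed forward to `Y` is `J + 𝓘_Z`** for a closed immersion `c : Z ↪ Y` and an ideal sheaf `J` on `Y`
(`c(V(J) ∩ Z) = V(J) ∩ Z = V(J + 𝓘_Z)`). [folklore] -/
theorem map_comap_of_isClosedImmersion (J : Y.IdealSheafData) : (J.comap c).map c = J ⊔ c.ker := by
  refine Scheme.IdealSheafData.ext (funext fun U => ?_)
  rw [ideal_map_of_isAffineHom, Literature.AlgebraicGeometry.Resolution.ideal_comap_preimage_of_isAffineHom,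
    Ideal.comap_map_of_surjective _ (c.app_surjective U U.2), ideal_sup, Pi.sup_apply, Scheme.Hom.ker_apply,
    RingHom.ker_eq_comap_bot]

/-- **Ideal of `T ↪ X_n ↪ X` when `T = T' ×_{X_{n+1}} X_n`**: for closed immersions `j : T ↪ X₁`, `j' : T' ↪ X₂`, `t : X₁ ↪ X₂`,
`ι' : X₂ ↪ X` and a CARTESIAN square `T = T' ×_{X₂} X₁`, the ideal of `T` in `X` is `𝓘_{T'} + 𝓘_{X₁}`. [folklore] -/
theorem ker_comp_eq_sup_of_isPullback {T T' X₁ X₂ X : Scheme.{u}} (j : T ⟶ X₁) (j' : T' ⟶ X₂) (t : X₁ ⟶ X₂)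
    (ι' : X₂ ⟶ X) [IsClosedImmersion j'] [IsClosedImmersion t] [IsClosedImmersion ι']
    (s : T ⟶ T') (hs : IsPullback s j j' t) :
    (j ≫ t ≫ ι').ker = (j' ≫ ι').ker ⊔ (t ≫ ι').ker := by
  have h1 : j.ker = j'.ker.comap t := by
    rw [← hs.flip.isoPullback_hom_fst, Scheme.Hom.ker_comp_of_isIso, ker_fst_of_isClosedImmersion]
  rw [← map_ker, map_comp, h1, map_comap_of_isClosedImmersion, map_sup_of_isClosedImmersion, map_ker, map_ker]

end ClosedImmersion

/-! ### The ideal of the infinitesimal neighbourhood `X_n = X ×_A A/Iⁿ⁺¹ ↪ X` -/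

section Thickening

variable {A : Type u} [CommRing A] (I : Ideal A) {X : Scheme.{u}} (f : X ⟶ Spec (.of A))

/-- `ofIdealTop` is multiplicative in powers. [folklore] -/
theorem ofIdealTop_pow (J : Ideal Γ(X, ⊤)) (k : ℕ) : ofIdealTop (J ^ k) = ofIdealTop J ^ k := by
  refine Scheme.IdealSheafData.ext (funext fun U => ?_)
  rw [ofIdealTop_ideal, ideal_pow, Pi.pow_apply, ofIdealTop_ideal, Ideal.map_pow]

/-- **The ideal of `ι_n : X_n = X ×_A A/Iⁿ⁺¹ ↪ X` is `Iⁿ⁺¹ · 𝒪_X`** (tree `Deformation.ker_eq_idealSheafOfIdeal_ker`: the ideal of a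
base change of `Spec (A ↠ A/Iⁿ⁺¹)` is `ker · 𝒪_X`). [folklore] -/
theorem ker_ι_eq (n : ℕ) : (ι I f n).ker = ofIdealTop ((I ^ (n + 1)).map (algebraMapΓ f)) := by
  have H : IsPullback (ι I f n) (toSpec I f n) f (base I n) := IsPullback.of_hasPullback f (base I n)
  rw [Literature.AlgebraicGeometry.Deformation.ker_eq_idealSheafOfIdeal_ker (Ideal.Quotient.mk (I ^ (n + 1)))
    Ideal.Quotient.mk_surjective (q := f) H, Literature.AlgebraicGeometry.Deformation.idealSheafOfIdeal, Ideal.mk_ker]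
  rfl

/-- The transition `X_n ↪ X_{n+1}` is a closed immersion (`X_n ↪ X` is and factors through it). [folklore] -/
theorem isClosedImmersion_transition (n : ℕ) : IsClosedImmersion (transition I f n) :=
  haveI : IsClosedImmersion (transition I f n ≫ ι I f (n + 1)) := by rw [transition_ι]; infer_instance
  IsClosedImmersion.of_comp_isClosedImmersion (transition I f n) (ι I f (n + 1))

/-- For a principal ideal of definition `I = (a)`: the ideal of `X_n ↪ X` is `(α)ⁿ⁺¹`, `α = f♯a`. [folklore] -/
theorem ker_ι_span_eq_powIdeal (a : A) (n : ℕ) :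
    (ι (Ideal.span {a}) f n).ker = ofIdealTop (Ideal.span {algebraMapΓ f a}) ^ (n + 1) := by
  rw [ker_ι_eq, Ideal.map_pow, Ideal.map_span, Set.image_singleton, ofIdealTop_pow]

end Thickening

/-! ### F-88♭: Grothendieck existence for closed formal subschemes, principal ideal of definition -/

section Main

open Literature.AlgebraicGeometry.Resolution (comap_map_of_isClosedImmersion)

/-- **F-88♭ — Grothendieck's existence theorem for closed formal subschemes (Görtz–Wedhorn II Prop. 24.109 / EGA III₁ Cor. 5.1.8),
PRINCIPAL ideal of definition, AS A THEOREM**: literally the body of the tree's NAMED FACT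
`Literature.AlgebraicGeometry.FormalGeometry.GrothendieckExistence` (F-88) with `I := Ideal.span {a}`. For `A` noetherian and
`(a)`-adically complete, `f : X ⟶ Spec A` proper with thickenings `X_n = X ×_A A/(a)ⁿ⁺¹`, every family of closed immersions
`j n : T n ⟶ X_n` with CARTESIAN squares `T_n → T_{n+1}` over the transitions comes from a closed immersion `i : T' ⟶ X` with
CARTESIAN squares `T_n = T' ×_X X_n`. Proof: `K_n := 𝓘(T_n ↪ X_n ↪ X)` satisfies `K_n = K_{n+1} + (α)ⁿ⁺¹`
(`ker_comp_eq_sup_of_isPullback`, `ker_ι_span_eq_powIdeal`), so brick 2 (`exists_idealSheaf_forall_eq_sup`) gives `K'` with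
`K_n = K' + (α)ⁿ⁺¹`; `T' := V(K')`, and `T_n = T' ×_X X_n` because both are closed subschemes of `X_n` with the same ideal
(Mathlib `isPullback_of_isClosedImmersion`). [cite: GortzWedhorn2023, Prop. 24.109 (p. 577, proof L10–11) with Thm. 24.94 (p. 566)]
[OURS · F-88♭ brick 3] counted 0; nothing of [Hironaka2017]. -/
theorem grothendieckExistence_principal ⦃A : Type u⦄ [CommRing A] [IsNoetherianRing A] (a : A)
    [IsAdicComplete (Ideal.span {a}) A] ⦃X : Scheme.{u}⦄ (f : X ⟶ Spec (.of A)) [IsProper f]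
    (T : ℕ → Scheme.{u}) (j : ∀ n, T n ⟶ infinitesimalNeighbourhood (Ideal.span {a}) f n)
    (s : ∀ n, T n ⟶ T (n + 1)) (hj : ∀ n, IsClosedImmersion (j n))
    (hs : ∀ n, IsPullback (s n) (j n) (j (n + 1)) (transition (Ideal.span {a}) f n)) :
    ∃ (T' : Scheme.{u}) (i : T' ⟶ X), IsClosedImmersion i ∧
      ∃ r : ∀ n, T n ⟶ T', ∀ n, IsPullback (r n) (j n) i (ι (Ideal.span {a}) f n) := by
  haveI := hj
  haveI := isClosedImmersion_transition (Ideal.span {a}) f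
  let K : ℕ → X.IdealSheafData := fun n => (j n ≫ ι (Ideal.span {a}) f n).ker
  have hK : ∀ n, K n = K (n + 1) ⊔ powIdeal (algebraMapΓ f a) n := fun n => by
    change (j n ≫ ι _ f n).ker = (j (n + 1) ≫ ι _ f (n + 1)).ker ⊔ _
    rw [powIdeal, ← ker_ι_span_eq_powIdeal f a n, ← transition_ι (Ideal.span {a}) f n]
    exact ker_comp_eq_sup_of_isPullback (j n) (j (n + 1)) (transition _ f n) (ι _ f (n + 1)) (s n) (hs n)
  obtain ⟨K', hK'⟩ := exists_idealSheaf_forall_eq_sup f a K hK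
  have hle : ∀ n, K'.subschemeι.ker ≤ (j n ≫ ι (Ideal.span {a}) f n).ker := fun n => by
    rw [ker_subschemeι]
    change K' ≤ K n
    rw [hK' n]
    exact le_sup_left
  refine ⟨K'.subscheme, K'.subschemeι, inferInstance,
    fun n => IsClosedImmersion.lift K'.subschemeι (j n ≫ ι (Ideal.span {a}) f n) (hle n), fun n => ?_⟩
  refine (isPullback_of_isClosedImmersion (j n) K'.subschemeι _ (ι (Ideal.span {a}) f n)
    (IsClosedImmersion.lift_fac _ _ _).symm ?_).flip
  rw [ker_subschemeι, ← comap_map_of_isClosedImmersion (ι (Ideal.span {a}) f n) (j n).ker, map_ker]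
  change K'.comap _ = (K n).comap _
  rw [hK' n, comap_sup, powIdeal, ← ker_ι_span_eq_powIdeal f a n, ← map_bot (ι (Ideal.span {a}) f n),
    comap_map_of_isClosedImmersion, sup_bot_eq]

/-- **F-88♭ in F-88's binders**: `GrothendieckExistence`'s body for every ideal of definition `I` which is PRINCIPAL
(`I = (a)`; e.g. the maximal ideal of a discrete valuation ring). [cite: GortzWedhorn2023, Prop. 24.109 (p. 577)]
[OURS · F-88♭ brick 3] -/
theorem grothendieckExistence_of_exists_eq_span ⦃A : Type u⦄ [CommRing A] [IsNoetherianRing A] (I : Ideal A)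
    (hI : ∃ a : A, I = Ideal.span {a}) [IsAdicComplete I A] ⦃X : Scheme.{u}⦄ (f : X ⟶ Spec (.of A)) [IsProper f]
    (T : ℕ → Scheme.{u}) (j : ∀ n, T n ⟶ infinitesimalNeighbourhood I f n) (s : ∀ n, T n ⟶ T (n + 1))
    (hj : ∀ n, IsClosedImmersion (j n)) (hs : ∀ n, IsPullback (s n) (j n) (j (n + 1)) (transition I f n)) :
    ∃ (T' : Scheme.{u}) (i : T' ⟶ X), IsClosedImmersion i ∧
      ∃ r : ∀ n, T n ⟶ T', ∀ n, IsPullback (r n) (j n) i (ι I f n) := by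
  obtain ⟨a, rfl⟩ := hI
  exact grothendieckExistence_principal a f T j s hj hs


/-- **F-88♭ over a principal ideal ring** (e.g. a complete discrete valuation ring `O` with `I = 𝔪_O` — the ONE instantiation
of F-88 in the crux chain, `A := O`, `I := 𝔪_O`, at `embeddedLiftFact_of_infinitesimal_of_grothendieckExistence` (p598091) and
`exists_flat_lift_of_firstOrder`): a DROP-IN replacement for `hGE I` there. [cite: GortzWedhorn2023, Prop. 24.109 (p. 577)]
[OURS · F-88♭ brick 3] -/
theorem grothendieckExistence_of_isPrincipalIdealRing ⦃A : Type u⦄ [CommRing A] [IsNoetherianRing A]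
    [IsPrincipalIdealRing A] (I : Ideal A) [IsAdicComplete I A] ⦃X : Scheme.{u}⦄ (f : X ⟶ Spec (.of A)) [IsProper f]
    (T : ℕ → Scheme.{u}) (j : ∀ n, T n ⟶ infinitesimalNeighbourhood I f n) (s : ∀ n, T n ⟶ T (n + 1))
    (hj : ∀ n, IsClosedImmersion (j n)) (hs : ∀ n, IsPullback (s n) (j n) (j (n + 1)) (transition I f n)) :
    ∃ (T' : Scheme.{u}) (i : T' ⟶ X), IsClosedImmersion i ∧
      ∃ r : ∀ n, T n ⟶ T', ∀ n, IsPullback (r n) (j n) i (ι I f n) :=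
  grothendieckExistence_of_exists_eq_span I (IsPrincipalIdealRing.principal I).principal f T j s hj hs

end Main

end GEPrincipal

end Summit.ResolutionOfSingularities.ResolutionOfSingularities.Cruxes.EquisingularLiftNat.Sections

end
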